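import Literature.Geometry.DiscreteGeometry.KissingSearchRules
import HarnessLib

/-!
# Soundness of the node rule and of propagation in the kissing growth search

Topic `Literature/Geometry/DiscreteGeometry`; provefact brick for `Hales2012_contactGraphTame` /
`Hales2012_contactGraphFccOrHcp`, part 5.  Everything here is PROVED; nothing is named
(`KConf.onSide`, `St.onSideL` are defined in `KissingSearchDefs.lean`).
For `M : KConf` and a realized state `s`:

* Part A — counting placed triangles on a side against the two triangles of `M`
  (`placed_of_gsc_two`, `exists_unplaced_of_gsc_one`, `gsc_le_two`); the semantics of
  `linkSummary`, `linkNbrs`, `linkReach` (contains its seeds), `linkClosed`;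
* Part B — the single-cycle link axiom at work: a CLOSED label (no side at it in exactly one
  placed triangle) has all its triangles placed (`all_placed_of_closed`), and a verified closed
  proper component kills soundly (`not_badLink`);
* Part C — `slotSums` and the angle sums: `Σ_{placed at v} ang = 2π` at a closed label, the
  window inequalities, `THMIN · δ ≤` every angle of `M`, and **`nodeRule_sound`**;
* Part D — `localStep_sound`, **`propagateWL_sound`**, `propagate_sound`.

## References
* T. C. Hales, arXiv:1209.6043 (2012), proof of Lemma 9 (node equations). [`Hales2012`]
* R. E. Moore, *Interval Analysis* (1966), §4.4. [`Moore1966`]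
-/

namespace Literature.Geometry.DiscreteGeometry

namespace KissingSearch

open Real Literature.Analysis.ValidatedNumerics KissingLP NonemptyInterval Finset

/-! ### Part A. Placed triangles on a side; link bookkeeping -/

section Counting

variable {M : KConf} {s : St}



/-- The images of the placed triangles through `{v, x}` form a subset of `M.onSide v x` of the
same size as the list. [folklore] -/
theorem card_image_onSideL (hR : Realizes M s) (v x : ℕ) :
    ((s.onSideL v x).map tset).toFinset ⊆ M.onSide v x ∧
      ((s.onSideL v x).map tset).toFinset.card = (s.onSideL v x).length := by
  constructor
  · intro t'' ht''
    rw [List.mem_toFinset, List.mem_map] at ht''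
    obtain ⟨t, ht, rfl⟩ := ht''
    unfold St.onSideL at ht
    rw [List.mem_filter] at ht
    simp only [Bool.and_eq_true] at ht
    unfold KConf.onSide
    rw [Finset.mem_filter]
    exact ⟨hR.mem t ht.1, tmem_iff.1 ht.2.1, tmem_iff.1 ht.2.2⟩
  · rw [List.card_toFinset, List.dedup_eq_self.2, List.length_map]
    refine (List.nodup_map_iff_inj_on ?_).2 ?_
    · exact hR.nodup.filter _
    · intro t ht t' ht' e
      unfold St.onSideL at ht ht'
      exact eq_of_tset_eq (hR.valid t (List.mem_filter.1 ht).1) (hR.valid t' (List.mem_filter.1 ht').1) e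

/-- `M.onSide v x` has two elements as soon as some placed triangle goes through `{v, x}`.
[folklore] -/
theorem card_onSide (hR : Realizes M s) {v x t : ℕ} (hvx : v ≠ x) (ht : t ∈ s.tris.toList)
    (hv : v ∈ tset t) (hx : x ∈ tset t) : (M.onSide v x).card = 2 :=
  M.two _ (hR.mem t ht) v hv x hx hvx

/-- The cached count is the length of the placed list. [folklore] -/
theorem gsc_eq_length (hR : Realizes M s) {v x : ℕ} (hv : v < 12) (hx : x < 12) (hvx : v ≠ x) :
    s.gsc v x = (s.onSideL v x).length := hR.sc_eq v x hv hx hvx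

/-- **At most two placed triangles on a side.** [folklore] -/
theorem gsc_le_two (hR : Realizes M s) {v x : ℕ} (hv : v < 12) (hx : x < 12) (hvx : v ≠ x) :
    s.gsc v x ≤ 2 := by
  rw [gsc_eq_length hR hv hx hvx]
  obtain ⟨hsub, hcard⟩ := card_image_onSideL hR v x
  by_cases h0 : s.onSideL v x = []
  · rw [h0]; simp
  · obtain ⟨t, ht⟩ := List.exists_mem_of_ne_nil _ h0
    have ht' := ht
    unfold St.onSideL at ht'
    rw [List.mem_filter] at ht'
    simp only [Bool.and_eq_true] at ht'
    have h2 := card_onSide hR hvx ht'.1 (tmem_iff.1 ht'.2.1) (tmem_iff.1 ht'.2.2)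
    rw [← hcard, ← h2]
    exact Finset.card_le_card hsub

/-- **Two placed triangles on a side are all the triangles of `M` on it.** [folklore] -/
theorem placed_of_gsc_two (hR : Realizes M s) {v x : ℕ} (hv : v < 12) (hx : x < 12) (hvx : v ≠ x)
    (h2 : s.gsc v x = 2) {t'' : Finset ℕ} (hT : t'' ∈ M.T) (hv'' : v ∈ t'') (hx'' : x ∈ t'') :
    ∃ t ∈ s.tris.toList, tset t = t'' := by
  rw [gsc_eq_length hR hv hx hvx] at h2
  obtain ⟨hsub, hcard⟩ := card_image_onSideL hR v x
  obtain ⟨t, ht⟩ := List.exists_mem_of_ne_nil (s.onSideL v x) (by intro h; rw [h] at h2; simp at h2)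
  have ht' := ht
  unfold St.onSideL at ht'
  rw [List.mem_filter] at ht'
  simp only [Bool.and_eq_true] at ht'
  have hc := card_onSide hR hvx ht'.1 (tmem_iff.1 ht'.2.1) (tmem_iff.1 ht'.2.2)
  have heq : ((s.onSideL v x).map tset).toFinset = M.onSide v x :=
    Finset.eq_of_subset_of_card_le hsub (by rw [hc, hcard, h2])
  have hmem : t'' ∈ M.onSide v x := by unfold KConf.onSide; rw [Finset.mem_filter]; exact ⟨hT, hv'', hx''⟩
  rw [← heq, List.mem_toFinset, List.mem_map] at hmem
  obtain ⟨t₀, ht₀, e⟩ := hmem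
  unfold St.onSideL at ht₀
  exact ⟨t₀, (List.mem_filter.1 ht₀).1, e⟩

/-- **One placed triangle on a side leaves an unplaced triangle of `M` on it.** [folklore] -/
theorem exists_unplaced_of_gsc_one (hR : Realizes M s) {v x : ℕ} (hv : v < 12) (hx : x < 12)
    (hvx : v ≠ x) (h1 : s.gsc v x = 1) :
    ∃ t'' ∈ M.T, v ∈ t'' ∧ x ∈ t'' ∧ ∀ t ∈ s.tris.toList, tset t ≠ t'' := by
  rw [gsc_eq_length hR hv hx hvx] at h1
  obtain ⟨hsub, hcard⟩ := card_image_onSideL hR v x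
  obtain ⟨t, ht⟩ := List.exists_mem_of_ne_nil (s.onSideL v x) (by intro h; rw [h] at h1; simp at h1)
  have ht' := ht
  unfold St.onSideL at ht'
  rw [List.mem_filter] at ht'
  simp only [Bool.and_eq_true] at ht'
  have hc := card_onSide hR hvx ht'.1 (tmem_iff.1 ht'.2.1) (tmem_iff.1 ht'.2.2)
  -- an element of `M.onSide v x` outside the one-element image
  have hlt : ((s.onSideL v x).map tset).toFinset.card < (M.onSide v x).card := by rw [hcard, h1, hc]; norm_num
  obtain ⟨t'', ht''1, ht''2⟩ := Finset.exists_of_ssubset (Finset.ssubset_iff_subset_ne.2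
    ⟨hsub, fun e => by rw [e] at hlt; exact lt_irrefl _ hlt⟩)
  unfold KConf.onSide at ht''1
  rw [Finset.mem_filter] at ht''1
  refine ⟨t'', ht''1.1, ht''1.2.1, ht''1.2.2, fun t₀ ht₀ e => ht''2 ?_⟩
  rw [List.mem_toFinset, List.mem_map]
  refine ⟨t₀, ?_, e⟩
  unfold St.onSideL
  rw [List.mem_filter]
  simp only [Bool.and_eq_true]
  rw [← e] at ht''1
  exact ⟨ht₀, tmem_iff.2 ht''1.2.1, tmem_iff.2 ht''1.2.2⟩

/-- **Meaning of `linkSummary`.**  With `L = [u < 12 | u ≠ v, gsc v u ≠ 0]` (increasing):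
`nv = |L|`, `ne = |[u ∈ L | gsc v u = 1]|`, `bad ↔ ∃ u ∈ L, 3 ≤ gsc v u`, `verts = L.reverse`.
[folklore] -/
theorem linkSummary_eq (s : St) (v : ℕ) :
    s.linkSummary v =
      (((List.range' 0 12).filter fun u => u ≠ v ∧ s.gsc v u ≠ 0).length,
       ((List.range' 0 12).filter fun u => u ≠ v ∧ s.gsc v u = 1).length,
       ((List.range' 0 12).any fun u => u ≠ v ∧ 3 ≤ s.gsc v u),
       ((List.range' 0 12).filter fun u => u ≠ v ∧ s.gsc v u ≠ 0).reverse) := by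
  unfold St.linkSummary
  rw [foldRange_eq_foldl]
  suffices h : ∀ (L : List ℕ) (acc : ℕ × ℕ × Bool × List ℕ),
      L.foldl (fun (acc : ℕ × ℕ × Bool × List ℕ) u =>
        if u = v then acc
        else if s.gsc v u = 0 then acc
        else (acc.1 + 1, (if s.gsc v u = 1 then acc.2.1 + 1 else acc.2.1), (acc.2.2.1 || decide (3 ≤ s.gsc v u)),
          u :: acc.2.2.2)) acc =
      (acc.1 + (L.filter fun u => u ≠ v ∧ s.gsc v u ≠ 0).length,
       acc.2.1 + (L.filter fun u => u ≠ v ∧ s.gsc v u = 1).length,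
       (acc.2.2.1 || L.any fun u => u ≠ v ∧ 3 ≤ s.gsc v u),
       (L.filter fun u => u ≠ v ∧ s.gsc v u ≠ 0).reverse ++ acc.2.2.2) by
    have := h (List.range' 0 12) (0, 0, false, [])
    simpa using this
  intro L
  induction L with
  | nil => intro acc; simp
  | cons u L ih =>
    intro acc
    rw [List.foldl_cons, ih]
    by_cases huv : u = v
    · simp [huv]
    · by_cases h0 : s.gsc v u = 0
      · simp [huv, h0]
      · by_cases h1 : s.gsc v u = 1
        · simp [huv, h1]
          omega
        · by_cases h3 : 3 ≤ s.gsc v u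
          · simp [huv, h0, h1, h3]
            omega
          · simp [huv, h0, h1, h3]
            omega

/-- **Meaning of `linkNbrs`**: the third vertices of the placed triangles through `{v, x}`
(`x ≠ v`), for valid placed triangles. [folklore] -/
theorem mem_linkNbrs (hR : Realizes M s) {v x y : ℕ} (hxv : x ≠ v) :
    y ∈ s.linkNbrs v x ↔ ∃ t ∈ s.tris.toList, v ∈ tset t ∧ x ∈ tset t ∧ tset t = {v, x, y} := by
  unfold St.linkNbrs
  rw [← Array.foldl_toList]
  have gen : ∀ (L : List ℕ) (acc : List ℕ), (∀ t ∈ L, TriValid t) →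
      (y ∈ L.foldl (fun l t => if (tmem t v && tmem t x && x != v) = true then
          (if (others t v).1 = x then (others t v).2 else (others t v).1) :: l else l) acc ↔
        y ∈ acc ∨ ∃ t ∈ L, v ∈ tset t ∧ x ∈ tset t ∧ tset t = {v, x, y}) := by
    intro L
    induction L with
    | nil => intro acc _; simp
    | cons t L ih =>
      intro acc hval
      rw [List.foldl_cons, ih _ (fun t' ht' => hval t' (by simp [ht']))]
      have hvt := hval t (by simp)
      by_cases hc : (tmem t v && tmem t x && x != v) = true
      · rw [if_pos hc, List.mem_cons]
        simp only [Bool.and_eq_true, bne_iff_ne, ne_eq] at hc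
        obtain ⟨⟨hv, hx⟩, -⟩ := hc
        have hv' := tmem_iff.1 hv
        have hx' := tmem_iff.1 hx
        obtain ⟨n1, n2, n12, hset⟩ := others_spec hvt hv'
        -- which of the two others is `x`
        have hx3 : x = (others t v).1 ∨ x = (others t v).2 := by
          rw [hset] at hx'
          simp only [Finset.mem_insert, Finset.mem_singleton] at hx'
          rcases hx' with h | h | h
          · exact absurd h hxv
          · exact Or.inl h
          · exact Or.inr h
        constructor
        · rintro ((rfl | hacc) | ⟨t', ht', h'⟩)
          · right
            refine ⟨t, by simp, hv', hx', ?_⟩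
            rcases hx3 with h | h
            · rw [if_pos h.symm, hset, ← h]
            · have hne : (others t v).1 ≠ x := by rw [h]; exact n12
              rw [if_neg hne, hset, ← h]
              -- {v, o1, x} = {v, x, o1}
              ext z; simp only [Finset.mem_insert, Finset.mem_singleton]; tauto
          · exact Or.inl hacc
          · exact Or.inr ⟨t', by simp [ht'], h'⟩
        · rintro (hacc | ⟨t', ht', hv'', hx'', hset'⟩)
          · exact Or.inl (Or.inr hacc)
          · rcases List.mem_cons.1 ht' with rfl | ht'
            · left; left
              -- `y` is the third vertex of `t`
              rcases hx3 with h | h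
              · rw [if_pos h.symm]
                have : (others t' v).2 ∈ ({v, x, y} : Finset ℕ) := by rw [← hset', hset]; simp
                simp only [Finset.mem_insert, Finset.mem_singleton] at this
                rcases this with e | e | e
                · exact absurd e.symm n2
                · rw [h] at e; exact absurd e.symm n12
                · exact e.symm
              · have hne : (others t' v).1 ≠ x := by rw [h]; exact n12
                rw [if_neg hne]
                have : (others t' v).1 ∈ ({v, x, y} : Finset ℕ) := by rw [← hset', hset]; simp
                simp only [Finset.mem_insert, Finset.mem_singleton] at this
                rcases this with e | e | e
                · exact absurd e.symm n1
                · exact absurd e hne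
                · exact e.symm
            · exact Or.inr ⟨t', ht', hv'', hx'', hset'⟩
      · rw [if_neg hc]
        constructor
        · rintro (hacc | ⟨t', ht', h'⟩)
          · exact Or.inl hacc
          · exact Or.inr ⟨t', by simp [ht'], h'⟩
        · rintro (hacc | ⟨t', ht', hv'', hx'', hset'⟩)
          · exact Or.inl hacc
          · rcases List.mem_cons.1 ht' with rfl | ht'
            · exfalso; apply hc
              simp only [Bool.and_eq_true, bne_iff_ne, ne_eq]
              exact ⟨⟨tmem_iff.2 hv'', tmem_iff.2 hx''⟩, hxv⟩
            · exact Or.inr ⟨t', ht', hv'', hx'', hset'⟩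
  rw [gen _ [] hR.valid]
  simp

/-- `linkReach` contains its `seen` list. [folklore] -/
theorem subset_linkReach (s : St) (v : ℕ) : ∀ (fuel : ℕ) (seen front : List ℕ) {a : ℕ},
    a ∈ seen → a ∈ s.linkReach v fuel seen front
  | 0, seen, front, a, h => by unfold St.linkReach; exact h
  | fuel + 1, seen, [], a, h => by unfold St.linkReach; exact h
  | fuel + 1, seen, x :: front, a, h => by
    unfold St.linkReach
    exact subset_linkReach s v fuel _ _ (List.mem_append_right _ h)

/-- **Meaning of `linkClosed`.** [folklore] -/
theorem linkClosed_iff (s : St) (v : ℕ) (C : List ℕ) :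
    s.linkClosed v C = true ↔ ∀ x ∈ C, ∀ y ∈ s.linkNbrs v x, y ∈ C := by
  unfold St.linkClosed
  simp [List.all_eq_true]

end Counting

/-! ### Part B. The single-cycle link axiom at work -/

section Link

variable {M : KConf} {s : St}

/-- Two sets meeting in two points have a common point other than any given `v`. [folklore] -/
theorem exists_common_of_inter_two {t t' : Finset ℕ} (v : ℕ)
    (h2 : (t ∩ t').card = 2) : ∃ x, x ≠ v ∧ x ∈ t ∧ x ∈ t' := by
  obtain ⟨p, q, hpq, hpq'⟩ := Finset.card_eq_two.1 h2
  have hp : p ∈ t ∩ t' := by rw [hpq']; simp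
  have hq : q ∈ t ∩ t' := by rw [hpq']; simp
  rw [Finset.mem_inter] at hp hq
  by_cases hpv : p = v
  · exact ⟨q, fun h => hpq (hpv.trans h.symm), hq.1, hq.2⟩
  · exact ⟨p, hpv, hp.1, hp.2⟩

/-- **A closed label has all its triangles placed.**  If `v` lies in a placed triangle, every
side at `v` lying in a placed triangle lies in two (`gsc v u ≠ 1`, counts `≤ 2`), then every
triangle of `M` at `v` is placed. [cite: Hales2012, proof of Lemma 9] -/
theorem all_placed_of_closed (hR : Realizes M s) {v : ℕ} (hv : v < 12)
    (hne : ∀ u, u < 12 → u ≠ v → s.gsc v u ≠ 1) {t₀ : ℕ} (ht₀ : t₀ ∈ s.tris.toList) (hv₀ : v ∈ tset t₀)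
    {t'' : Finset ℕ} (hT : t'' ∈ M.T) (hv'' : v ∈ t'') : ∃ t ∈ s.tris.toList, tset t = t'' := by
  classical
  set A : Finset (Finset ℕ) := (M.T.filter fun t' => v ∈ t').filter fun t' => ∃ t ∈ s.tris.toList, tset t = t' with hA
  have hAsub : A ⊆ M.T.filter fun t' => v ∈ t' := Finset.filter_subset _ _
  have hAne : A.Nonempty := ⟨tset t₀, by
    rw [hA, Finset.mem_filter, Finset.mem_filter]; exact ⟨⟨hR.mem t₀ ht₀, hv₀⟩, t₀, ht₀, rfl⟩⟩
  have hcl : ∀ t ∈ A, ∀ t' ∈ M.T, v ∈ t' → (t ∩ t').card = 2 → t' ∈ A := by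
    intro t ht t' ht' hvt' h2
    rw [hA, Finset.mem_filter, Finset.mem_filter] at ht
    obtain ⟨⟨-, hvt⟩, tp, htp, rfl⟩ := ht
    obtain ⟨x, hxv, hx, hx'⟩ := exists_common_of_inter_two v h2
    have hx12 : x < 12 := lt_of_mem_tset (hR.valid tp htp) hx
    -- the side `{v, x}` is in a placed triangle, hence in two
    have hge : s.gsc v x ≠ 0 := by
      rw [gsc_eq_length hR hv hx12 hxv.symm]
      intro h0
      have : tp ∈ s.onSideL v x := by
        unfold St.onSideL; rw [List.mem_filter]; simp only [Bool.and_eq_true]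
        exact ⟨htp, tmem_iff.2 hvt, tmem_iff.2 hx⟩
      rw [List.length_eq_zero_iff.1 h0] at this
      simp at this
    have h2' : s.gsc v x = 2 := by
      have := gsc_le_two hR hv hx12 hxv.symm
      have := hne x hx12 hxv
      omega
    obtain ⟨t₁, ht₁, e⟩ := placed_of_gsc_two hR hv hx12 hxv.symm h2' ht' hvt' hx'
    rw [hA, Finset.mem_filter, Finset.mem_filter]
    exact ⟨⟨ht', hvt'⟩, t₁, ht₁, e⟩
  have hAeq := M.link v hv A hAsub hAne hcl
  have : t'' ∈ A := by rw [hAeq, Finset.mem_filter]; exact ⟨hT, hv''⟩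
  rw [hA, Finset.mem_filter] at this
  exact this.2

/-- **A verified closed proper component of the placed link contradicts the link axiom.**
[cite: Hales2012, proof of Lemma 9] -/
theorem false_of_closed_component (hR : Realizes M s) {v : ℕ} (hv : v < 12) {C : List ℕ} {a z : ℕ}
    (haC : a ∈ C) (ha : a < 12) (hav : a ≠ v) (hga : s.gsc v a ≠ 0)
    (hcl : ∀ x ∈ C, ∀ y ∈ s.linkNbrs v x, y ∈ C) (h2 : ∀ x ∈ C, s.gsc v x = 2)
    (hz : z < 12) (hzv : z ≠ v) (hgz : s.gsc v z ≠ 0) (hzC : z ∉ C) : False := by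
  classical
  -- the placed triangles at `v` whose other vertices are in `C`
  set A : Finset (Finset ℕ) := (M.T.filter fun t' => v ∈ t').filter
    fun t' => ∃ t ∈ s.tris.toList, tset t = t' ∧ ∀ x ∈ t', x ≠ v → x ∈ C with hA
  have hAsub : A ⊆ M.T.filter fun t' => v ∈ t' := Finset.filter_subset _ _
  -- a placed triangle through `{v, a}`
  have exa : ∃ t ∈ s.tris.toList, v ∈ tset t ∧ a ∈ tset t := by
    rw [gsc_eq_length hR hv ha hav.symm] at hga
    obtain ⟨t, ht⟩ := List.exists_mem_of_ne_nil (s.onSideL v a) (fun h => hga (by rw [h]; rfl))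
    unfold St.onSideL at ht
    rw [List.mem_filter] at ht
    simp only [Bool.and_eq_true] at ht
    exact ⟨t, ht.1, tmem_iff.1 ht.2.1, tmem_iff.1 ht.2.2⟩
  -- membership criterion for `A`: a placed triangle `{v, x, y}` with `x ∈ C` (then `y ∈ C`)
  have crit : ∀ t ∈ s.tris.toList, ∀ x, v ∈ tset t → x ∈ tset t → x ≠ v → x ∈ C → tset t ∈ A := by
    intro t ht x hvt hxt hxv hxC
    obtain ⟨n1, n2, n12, hset⟩ := others_spec (hR.valid t ht) hvt
    -- the third vertex `y`
    have hx3 : x = (others t v).1 ∨ x = (others t v).2 := by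
      rw [hset] at hxt; simp only [Finset.mem_insert, Finset.mem_singleton] at hxt
      rcases hxt with h | h | h
      · exact absurd h hxv
      · exact Or.inl h
      · exact Or.inr h
    obtain ⟨y, hy⟩ : ∃ y, tset t = {v, x, y} := by
      rcases hx3 with h | h
      · exact ⟨(others t v).2, by rw [hset, h]⟩
      · exact ⟨(others t v).1, by rw [hset, h]; ext z; simp only [Finset.mem_insert, Finset.mem_singleton]; tauto⟩
    have hyN : y ∈ s.linkNbrs v x := (mem_linkNbrs hR hxv).2 ⟨t, ht, hvt, hxt, hy⟩
    have hyC : y ∈ C := hcl x hxC y hyN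
    rw [hA, Finset.mem_filter, Finset.mem_filter]
    refine ⟨⟨hR.mem t ht, hvt⟩, t, ht, rfl, fun w hw hwv => ?_⟩
    rw [hy] at hw
    simp only [Finset.mem_insert, Finset.mem_singleton] at hw
    rcases hw with rfl | rfl | rfl
    · exact absurd rfl hwv
    · exact hxC
    · exact hyC
  obtain ⟨t₀, ht₀, hv₀, ha₀⟩ := exa
  have hAne : A.Nonempty := ⟨tset t₀, crit t₀ ht₀ a hv₀ ha₀ hav haC⟩
  have hclA : ∀ t ∈ A, ∀ t' ∈ M.T, v ∈ t' → (t ∩ t').card = 2 → t' ∈ A := by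
    intro t ht t' ht' hvt' hint
    rw [hA, Finset.mem_filter, Finset.mem_filter] at ht
    obtain ⟨⟨-, hvt⟩, tp, htp, rfl, hall⟩ := ht
    obtain ⟨x, hxv, hx, hx'⟩ := exists_common_of_inter_two v hint
    have hxC : x ∈ C := hall x hx hxv
    have hx12 : x < 12 := lt_of_mem_tset (hR.valid tp htp) hx
    obtain ⟨t₁, ht₁, e⟩ := placed_of_gsc_two hR hv hx12 hxv.symm (h2 x hxC) ht' hvt' hx'
    rw [← e]
    exact crit t₁ ht₁ x (by rw [e]; exact hvt') (by rw [e]; exact hx') hxv hxC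
  have hAeq := M.link v hv A hAsub hAne hclA
  -- the placed triangle through `{v, z}` is in `A`, so `z ∈ C`
  rw [gsc_eq_length hR hv hz hzv.symm] at hgz
  obtain ⟨tz, htz⟩ := List.exists_mem_of_ne_nil (s.onSideL v z) (fun h => hgz (by rw [h]; rfl))
  unfold St.onSideL at htz
  rw [List.mem_filter] at htz
  simp only [Bool.and_eq_true] at htz
  have hzT : tset tz ∈ A := by
    rw [hAeq, Finset.mem_filter]; exact ⟨hR.mem tz htz.1, tmem_iff.1 htz.2.1⟩
  rw [hA, Finset.mem_filter, Finset.mem_filter] at hzT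
  obtain ⟨-, tp, htp, e, hall⟩ := hzT
  exact hzC (hall z (tmem_iff.1 htz.2.2) hzv)

/-- **The link kill is sound**: in a realized state `badLink` is `false`. [folklore] -/
theorem not_badLink (hR : Realizes M s) {v : ℕ} (hv : v < 12) :
    s.badLink v (s.linkSummary v).2.2.2 (s.linkSummary v).2.2.1 = false := by
  rw [linkSummary_eq]
  simp only
  unfold St.badLink
  rw [Bool.or_eq_false_iff]
  constructor
  · -- no side in `≥ 3` placed triangles
    rw [List.any_eq_false]
    intro u hu h
    simp only [decide_eq_true_eq] at h
    rw [List.mem_range'_1] at hu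
    have := gsc_le_two hR hv (by omega) h.1.symm
    omega
  · -- no verified closed proper component
    set verts := ((List.range' 0 12).filter fun u => u ≠ v ∧ s.gsc v u ≠ 0).reverse with hverts
    have hmem : ∀ u, u ∈ verts ↔ u < 12 ∧ u ≠ v ∧ s.gsc v u ≠ 0 := by
      intro u; rw [hverts, List.mem_reverse, List.mem_filter, List.mem_range'_1]
      simp only [decide_eq_true_eq]; omega
    -- the fold: its flag becomes `true` only through a witness
    suffices h : ∀ (L : List ℕ) (acc : List ℕ × Bool), (∀ a ∈ L, a ∈ verts) → acc.2 = false →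
        (L.foldl (fun (acc : List ℕ × Bool) a =>
          if (acc.2 || acc.1.contains a) = true then acc
          else (s.linkReach v 24 [a] [a] ++ acc.1,
            s.linkClosed v (s.linkReach v 24 [a] [a]) &&
              (s.linkReach v 24 [a] [a]).all (fun x => s.gsc v x == 2) &&
              verts.any fun z => !(s.linkReach v 24 [a] [a]).contains z)) acc).2 = false by
      exact h verts ([], false) (fun a ha => ha) rfl
    intro L
    induction L with
    | nil => intro acc _ h; simpa using h
    | cons a L ih =>
      intro acc hL hacc
      rw [List.foldl_cons]
      apply ih _ (fun a' ha' => hL a' (by simp [ha']))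
      by_cases hskip : (acc.2 || acc.1.contains a) = true
      · rw [if_pos hskip]; exact hacc
      · rw [if_neg hskip]
        simp only
        -- the new flag is false: otherwise a closed proper component
        by_contra hflag
        rw [Bool.not_eq_false, Bool.and_eq_true, Bool.and_eq_true] at hflag
        obtain ⟨⟨hcl, hall⟩, hany⟩ := hflag
        rw [linkClosed_iff] at hcl
        rw [List.all_eq_true] at hall
        rw [List.any_eq_true] at hany
        obtain ⟨z, hz, hzC⟩ := hany
        have hzC' : z ∉ s.linkReach v 24 [a] [a] := by
          intro hm; simp [hm] at hzC
        have ha := (hmem a).1 (hL a (by simp))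
        have hz' := (hmem z).1 hz
        refine false_of_closed_component hR hv (C := s.linkReach v 24 [a] [a])
          (subset_linkReach s v 24 [a] [a] (by simp)) ha.1 ha.2.1 ha.2.2 hcl ?_ hz'.1 hz'.2.1 hz'.2.2 hzC'
        intro x hx
        have := hall x hx
        simpa using this

end Link

/-! ### Part C. Angle sums and the node rule -/

section Node

variable {M : KConf} {s : St}

/-- `trisAt` is the filter of the placed list. [folklore] -/
theorem trisAt_eq_filter (s : St) (v : ℕ) : s.trisAt v = s.tris.toList.filter fun t => tmem t v := by
  unfold St.trisAt
  rw [← Array.foldr_toList]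
  induction s.tris.toList with
  | nil => rfl
  | cons t L ih =>
    rw [List.foldr_cons, List.filter_cons, ih]

/-- **Meaning of `slotSums`** when every slot is feasible. [folklore] -/
theorem slotSums_eq_some (s : St) (v : ℕ) : ∀ (tv : List ℕ), (∀ t ∈ tv, s.slotBr t v ≠ NOBR) →
    s.slotSums v tv = some ((tv.map fun t => brLo (s.slotBr t v)).sum, (tv.map fun t => brHi (s.slotBr t v)).sum) := by
  intro tv
  induction tv using List.reverseRecOn with
  | nil => intro _; rfl
  | append_singleton L t ih =>
    intro hL
    have ht := hL t (by simp)
    have ih' := ih (fun t' ht' => hL t' (by simp [ht']))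
    unfold St.slotSums at ih' ⊢
    rw [List.foldl_append, ih', List.foldl_cons, List.foldl_nil]
    simp only [ht, ↓reduceIte, List.map_append, List.map_cons, List.map_nil, List.sum_append, List.sum_cons,
      List.sum_nil, add_zero]

/-- `12867 δ < 2π`. [folklore] -/
theorem TWOPI_LO_mul_lt : ((TWOPI_LO : ℕ) : ℝ) * (δ : ℝ) < 2 * π := by
  have := pi_gt_d6
  unfold TWOPI_LO δ; push_cast; norm_num; linarith

/-- `2π < 12868 δ`. [folklore] -/
theorem lt_TWOPI_HI_mul : 2 * π < ((TWOPI_HI : ℕ) : ℝ) * (δ : ℝ) := by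
  have := pi_lt_d6
  unfold TWOPI_HI δ; push_cast; norm_num; linarith

/-- **Every angle of `M` at a vertex is at least `THMIN δ`.** [folklore] -/
theorem THMIN_mul_le_ang (M : KConf) {t : Finset ℕ} (hT : t ∈ M.T) {v : ℕ} (hv : v ∈ t) :
    ((THMIN : ℕ) : ℝ) * (δ : ℝ) ≤ M.ang t v := by
  obtain ⟨hcard, hlt⟩ := M.mem_T t hT
  obtain ⟨x, y, z, hxy, hxz, hyz, rfl⟩ := Finset.card_eq_three.1 hcard
  -- name the two other vertices `a, b`
  obtain ⟨a, b, hva, hvb, hab, ha, hb⟩ : ∃ a b, v ≠ a ∧ v ≠ b ∧ a ≠ b ∧ a ∈ ({x, y, z} : Finset ℕ) ∧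
      b ∈ ({x, y, z} : Finset ℕ) := by
    simp only [Finset.mem_insert, Finset.mem_singleton] at hv
    rcases hv with rfl | rfl | rfl
    · exact ⟨y, z, hxy, hxz, hyz, by simp, by simp⟩
    · exact ⟨x, z, fun h => hxy h.symm, hyz, hxz, by simp, by simp⟩
    · exact ⟨x, y, fun h => hxz h.symm, fun h => hyz h.symm, hxy, by simp, by simp⟩
  -- symbols for the three sides
  have sym : ∀ {p q : ℕ}, p ∈ ({x, y, z} : Finset ℕ) → q ∈ ({x, y, z} : Finset ℕ) → p ≠ q →
      ∃ σ, σ ≤ K ∧ SymMem σ (M.g p q) := by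
    intro p q hp hq hpq
    rcases M.dichot p q (hlt p hp) (hlt q hq) hpq with h | ⟨-, h⟩
    · exact ⟨0, Nat.zero_le _, symMem_zero_iff.2 h⟩
    · have hlo := M.side_bound _ hT p hp q hq hpq
      have h0 : ((gridPt (1 - 1) : ℚ) : ℝ) ≤ M.g p q := by
        have : gridPt 0 = -1 / 2 := by unfold gridPt; simp
        rw [show (1 - 1 : ℕ) = 0 from rfl, this]; push_cast; linarith
      have hK : M.g p q ≤ ((gridPt K : ℚ) : ℝ) := by
        have : gridPt K = κ0 := by unfold gridPt K; ring
        rw [this]; exact h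
      obtain ⟨σ, h1, h2, h3⟩ := exists_cell (K - 1) 1 K (by unfold K; norm_num) le_rfl h0 hK
      exact ⟨σ, h2, h3⟩
  obtain ⟨σa, hσa, hxa⟩ := sym hv ha hva
  obtain ⟨σb, hσb, hxb⟩ := sym hv hb hvb
  obtain ⟨σc, hσc, hxc⟩ := sym ha hb hab
  have hbasic := basic_sound hxa hxb hxc (sq_lt_one_of_symMem hσa hxa) (sq_lt_one_of_symMem hσb hxb)
    (M.circum _ hT v hv a ha b hb hva hvb hab) (M.ang_nonneg _ _) (M.ang_le_pi _ _)
    (M.cos_law _ hT v hv a ha b hb hva hvb hab)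
  obtain ⟨hne, hlo, -⟩ := hbasic
  have hK' : K = 15 := rfl
  have hNS : NS = 16 := NS_eq
  have hTH := THMIN_le (by omega) (by omega) (by omega) hne
  exact le_trans (mul_le_mul_of_nonneg_right (by exact_mod_cast hTH) delta_pos.le) hlo

/-- The image of the placed triangles at a closed `v` is the set of all triangles of `M` at `v`,
and the list angle sum is `2π`. [cite: Hales2012, proof of Lemma 9] -/
theorem sum_ang_trisAt_of_closed (hR : Realizes M s) {v : ℕ} (hv : v < 12)
    (hne : ∀ u, u < 12 → u ≠ v → s.gsc v u ≠ 1) (hex : ∃ t ∈ s.tris.toList, v ∈ tset t) :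
    ((s.trisAt v).map fun t => M.ang (tset t) v).sum = 2 * π := by
  classical
  have hnd : (s.trisAt v).Nodup := by rw [trisAt_eq_filter]; exact hR.nodup.filter _
  -- list sum = finset sum over the image
  have hinj : ∀ t ∈ s.trisAt v, ∀ t' ∈ s.trisAt v, tset t = tset t' → t = t' := fun t ht t' ht' e =>
    eq_of_tset_eq (hR.valid t (mem_trisAt.1 ht).1) (hR.valid t' (mem_trisAt.1 ht').1) e
  have himg : ((s.trisAt v).toFinset).image tset = M.T.filter fun t' => v ∈ t' := by
    ext t''
    rw [Finset.mem_image, Finset.mem_filter]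
    constructor
    · rintro ⟨t, ht, rfl⟩
      rw [List.mem_toFinset] at ht
      exact ⟨hR.mem t (mem_trisAt.1 ht).1, tmem_iff.1 (mem_trisAt.1 ht).2⟩
    · rintro ⟨hT, hv''⟩
      obtain ⟨t₀, ht₀, hv₀⟩ := hex
      obtain ⟨t, ht, e⟩ := all_placed_of_closed hR hv hne ht₀ hv₀ hT hv''
      refine ⟨t, ?_, e⟩
      rw [List.mem_toFinset, mem_trisAt]
      exact ⟨ht, tmem_iff.2 (by rw [e]; exact hv'')⟩
  calc ((s.trisAt v).map fun t => M.ang (tset t) v).sum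
      = ∑ t ∈ (s.trisAt v).toFinset, M.ang (tset t) v := (List.sum_toFinset _ hnd).symm
    _ = ∑ t'' ∈ ((s.trisAt v).toFinset).image tset, M.ang t'' v := by
        rw [Finset.sum_image]
        intro t ht t' ht' e
        exact hinj t (List.mem_toFinset.1 ht) t' (List.mem_toFinset.1 ht') e
    _ = ∑ t'' ∈ M.T.filter (fun t' => v ∈ t'), M.ang t'' v := by rw [himg]
    _ = ∑ t'' ∈ M.T, M.ang t'' v := by
        rw [Finset.sum_filter]
        refine Finset.sum_congr rfl fun t'' ht'' => ?_
        split_ifs with h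
        · rfl
        · exact (M.ang_zero t'' ht'' v h).symm
    _ = 2 * π := M.node v hv

/-- At an open label, the placed angle sum plus one more angle of `M` is at most `2π`.
[cite: Hales2012, proof of Lemma 9] -/
theorem sum_ang_trisAt_add_le (hR : Realizes M s) {v : ℕ} (hv : v < 12) {t'' : Finset ℕ}
    (hT : t'' ∈ M.T) (hv'' : v ∈ t'') (hun : ∀ t ∈ s.tris.toList, tset t ≠ t'') :
    ((s.trisAt v).map fun t => M.ang (tset t) v).sum + M.ang t'' v ≤ 2 * π := by
  classical
  have hnd : (s.trisAt v).Nodup := by rw [trisAt_eq_filter]; exact hR.nodup.filter _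
  have hinj : ∀ t ∈ (s.trisAt v).toFinset, ∀ t' ∈ (s.trisAt v).toFinset, tset t = tset t' → t = t' :=
    fun t ht t' ht' e => eq_of_tset_eq (hR.valid t (mem_trisAt.1 (List.mem_toFinset.1 ht)).1)
      (hR.valid t' (mem_trisAt.1 (List.mem_toFinset.1 ht')).1) e
  set I := ((s.trisAt v).toFinset).image tset with hI
  have hIsub : insert t'' I ⊆ M.T := by
    intro x hx
    rw [Finset.mem_insert] at hx
    rcases hx with rfl | hx
    · exact hT
    · rw [hI, Finset.mem_image] at hx
      obtain ⟨t, ht, rfl⟩ := hx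
      exact hR.mem t (mem_trisAt.1 (List.mem_toFinset.1 ht)).1
  have hnot : t'' ∉ I := by
    rw [hI, Finset.mem_image]
    rintro ⟨t, ht, e⟩
    exact hun t (mem_trisAt.1 (List.mem_toFinset.1 ht)).1 e
  calc ((s.trisAt v).map fun t => M.ang (tset t) v).sum + M.ang t'' v
      = (∑ x ∈ I, M.ang x v) + M.ang t'' v := by
        rw [← List.sum_toFinset _ hnd, hI, Finset.sum_image hinj]
    _ = ∑ x ∈ insert t'' I, M.ang x v := by rw [Finset.sum_insert hnot, add_comm]
    _ ≤ ∑ x ∈ M.T, M.ang x v := Finset.sum_le_sum_of_subset_of_nonneg hIsub (fun x _ _ => M.ang_nonneg _ _)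
    _ = 2 * π := M.node v hv

/-- Lower and upper bracket sums bound the list angle sum. [folklore] -/
theorem bracket_sums_bound (hR : Realizes M s) (v : ℕ) (L : List ℕ) (hL : ∀ t ∈ L, t ∈ s.trisAt v) :
    (((L.map fun t => brLo (s.slotBr t v)).sum : ℕ) : ℝ) * (δ : ℝ) ≤ (L.map fun t => M.ang (tset t) v).sum ∧
      (L.map fun t => M.ang (tset t) v).sum ≤ (((L.map fun t => brHi (s.slotBr t v)).sum : ℕ) : ℝ) * (δ : ℝ) := by
  induction L with
  | nil => simp
  | cons t L ih =>
    obtain ⟨i1, i2⟩ := ih (fun t' ht' => hL t' (by simp [ht']))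
    have ht := mem_trisAt.1 (hL t (by simp))
    obtain ⟨-, hlo, hhi⟩ := slot_encl hR ht.1 (tmem_iff.1 ht.2)
    simp only [List.map_cons, List.sum_cons, Nat.cast_add, add_mul]
    exact ⟨add_le_add hlo i1, add_le_add hhi i2⟩

/-- **The window of a slot at a closed label contains its angle.** [cite: Moore1966, §4.4] -/
theorem window_of_closed (hR : Realizes M s) {v : ℕ} (hv : v < 12)
    (hne : ∀ u, u < 12 → u ≠ v → s.gsc v u ≠ 1) {t : ℕ} (ht : t ∈ s.trisAt v) {sl sh : ℕ}
    (hsl : sl = ((s.trisAt v).map fun t => brLo (s.slotBr t v)).sum)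
    (hsh : sh = ((s.trisAt v).map fun t => brHi (s.slotBr t v)).sum) :
    ((TWOPI_LO - (sh - brHi (s.slotBr t v)) : ℕ) : ℝ) * (δ : ℝ) ≤ M.ang (tset t) v ∧
      M.ang (tset t) v ≤ ((TWOPI_HI - (sl - brLo (s.slotBr t v)) : ℕ) : ℝ) * (δ : ℝ) := by
  classical
  have htl := mem_trisAt.1 ht
  have hsum := sum_ang_trisAt_of_closed hR hv hne ⟨t, htl.1, tmem_iff.1 htl.2⟩
  -- split the list at `t`
  obtain ⟨l₁, l₂, hsplit⟩ := List.append_of_mem ht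
  have hrest : ∀ t' ∈ l₁ ++ l₂, t' ∈ s.trisAt v := by
    intro t' ht'; rw [hsplit]; rw [List.mem_append] at ht' ⊢
    rcases ht' with h | h
    · exact Or.inl h
    · exact Or.inr (List.mem_cons_of_mem _ h)
  obtain ⟨rlo, rhi⟩ := bracket_sums_bound hR v (l₁ ++ l₂) hrest
  -- sums decompose
  have eA : ((s.trisAt v).map fun t => M.ang (tset t) v).sum =
      M.ang (tset t) v + ((l₁ ++ l₂).map fun t => M.ang (tset t) v).sum := by
    rw [hsplit]; simp only [List.map_append, List.map_cons, List.sum_append, List.sum_cons]; ring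
  have eL : sl = brLo (s.slotBr t v) + ((l₁ ++ l₂).map fun t => brLo (s.slotBr t v)).sum := by
    rw [hsl, hsplit]; simp only [List.map_append, List.map_cons, List.sum_append, List.sum_cons]; ring
  have eH : sh = brHi (s.slotBr t v) + ((l₁ ++ l₂).map fun t => brHi (s.slotBr t v)).sum := by
    rw [hsh, hsplit]; simp only [List.map_append, List.map_cons, List.sum_append, List.sum_cons]; ring
  set R := ((l₁ ++ l₂).map fun t => M.ang (tset t) v).sum with hRdef
  set RL := ((l₁ ++ l₂).map fun t => brLo (s.slotBr t v)).sum with hRL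
  set RH := ((l₁ ++ l₂).map fun t => brHi (s.slotBr t v)).sum with hRH
  have hθ : M.ang (tset t) v = 2 * π - R := by linarith
  have h2lo := TWOPI_LO_mul_lt
  have h2hi := lt_TWOPI_HI_mul
  have hδ := delta_pos
  obtain ⟨-, ownlo, ownhi⟩ := slot_encl hR htl.1 (tmem_iff.1 htl.2)
  constructor
  · -- lower window
    have esub : sh - brHi (s.slotBr t v) = RH := by rw [eH]; omega
    rw [esub]
    by_cases hle : RH ≤ TWOPI_LO
    · rw [Nat.cast_sub hle, sub_mul]; linarith
    · rw [Nat.sub_eq_zero_of_le (by omega : TWOPI_LO ≤ RH)]; simp [M.ang_nonneg]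
  · -- upper window
    have esub : sl - brLo (s.slotBr t v) = RL := by rw [eL]; omega
    rw [esub]
    by_cases hle : RL ≤ TWOPI_HI
    · rw [Nat.cast_sub hle, sub_mul]; linarith
    · exfalso
      have : ((TWOPI_HI : ℕ) : ℝ) * (δ : ℝ) < (RL : ℝ) * (δ : ℝ) :=
        mul_lt_mul_of_pos_right (by exact_mod_cast (not_le.1 hle)) hδ
      have hR0 : 0 ≤ M.ang (tset t) v := M.ang_nonneg _ _
      linarith

/-- **Soundness of `nodeRule`.** [cite: Hales2012, proof of Lemma 9 (node equations)] -/
theorem nodeRule_sound (hR : Realizes M s) {v : ℕ} (hv : v < 12) :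
    s.nodeRule v ≠ none ∧ ∀ s', s.nodeRule v = some s' → Realizes M s' ∧ s'.tris = s.tris := by
  classical
  have hbad := not_badLink hR hv
  unfold St.nodeRule
  -- destructure the summary
  rw [show s.linkSummary v = ((s.linkSummary v).1, (s.linkSummary v).2.1, (s.linkSummary v).2.2.1,
    (s.linkSummary v).2.2.2) from rfl]
  simp only
  rw [hbad]
  have hLS := linkSummary_eq s v
  have e1 : (s.linkSummary v).1 = ((List.range' 0 12).filter fun u => u ≠ v ∧ s.gsc v u ≠ 0).length := by
    rw [hLS]
  have e2 : (s.linkSummary v).2.1 = ((List.range' 0 12).filter fun u => u ≠ v ∧ s.gsc v u = 1).length := by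
    rw [hLS]
  by_cases hnv : (s.linkSummary v).1 = 0
  · rw [if_pos hnv]; exact ⟨by simp, fun s' h => by cases h; exact ⟨hR, rfl⟩⟩
  · rw [if_neg hnv]
    simp only [Bool.false_eq_true, ↓reduceIte]
    -- slots are feasible
    have hfeas : ∀ t ∈ s.trisAt v, s.slotBr t v ≠ NOBR := fun t ht =>
      (slot_encl hR (mem_trisAt.1 ht).1 (tmem_iff.1 (mem_trisAt.1 ht).2)).1
    rw [slotSums_eq_some s v _ hfeas]
    simp only
    set sl := ((s.trisAt v).map fun t => brLo (s.slotBr t v)).sum with hsl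
    set sh := ((s.trisAt v).map fun t => brHi (s.slotBr t v)).sum with hsh
    obtain ⟨blo, bhi⟩ := bracket_sums_bound hR v (s.trisAt v) (fun t ht => ht)
    -- a placed triangle at `v` (from `nv ≠ 0`)
    have hex : ∃ t ∈ s.tris.toList, v ∈ tset t := by
      rw [e1] at hnv
      obtain ⟨u, hu⟩ := List.exists_mem_of_ne_nil ((List.range' 0 12).filter fun u => u ≠ v ∧ s.gsc v u ≠ 0)
        (fun h => hnv (by rw [h]; rfl))
      simp only [List.mem_filter, List.mem_range'_1, decide_eq_true_eq] at hu
      obtain ⟨hu12, huv, hg⟩ := hu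
      rw [gsc_eq_length hR hv (by omega) (Ne.symm huv)] at hg
      obtain ⟨t, ht⟩ := List.exists_mem_of_ne_nil (s.onSideL v u) (fun h => hg (by rw [h]; rfl))
      unfold St.onSideL at ht; rw [List.mem_filter] at ht; simp only [Bool.and_eq_true] at ht
      exact ⟨t, ht.1, tmem_iff.1 ht.2.1⟩
    by_cases hne0 : (s.linkSummary v).2.1 = 0
    · -- closed label
      rw [if_pos hne0]
      have hne : ∀ u, u < 12 → u ≠ v → s.gsc v u ≠ 1 := by
        intro u hu huv h1
        rw [e2] at hne0
        have : u ∈ (List.range' 0 12).filter (fun u => u ≠ v ∧ s.gsc v u = 1) := by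
          simp only [List.mem_filter, List.mem_range'_1, decide_eq_true_eq]; exact ⟨by omega, huv, h1⟩
        rw [List.length_eq_zero_iff.1 hne0] at this; simp at this
      have hsum := sum_ang_trisAt_of_closed hR hv hne hex
      have h2lo := TWOPI_LO_mul_lt
      have h2hi := lt_TWOPI_HI_mul
      have hδ := delta_pos
      have hkill : ¬ (TWOPI_HI ≤ sl ∨ sh < TWOPI_LO) := by
        rintro (h | h)
        · have : ((TWOPI_HI : ℕ) : ℝ) * (δ : ℝ) ≤ (sl : ℝ) * δ := mul_le_mul_of_nonneg_right (by exact_mod_cast h) hδ.le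
          linarith
        · have : ((sh : ℕ) : ℝ) * (δ : ℝ) < (TWOPI_LO : ℝ) * δ := mul_lt_mul_of_pos_right (by exact_mod_cast h) hδ
          linarith
      rw [if_neg hkill]
      -- the trims
      unfold St.trimAt
      have gen : ∀ (L : List ℕ), (∀ t ∈ L, t ∈ s.trisAt v) → ∀ (s1 : St), Realizes M s1 → s1.tris = s.tris →
          (L.foldl (fun os t => match os with
            | none => none
            | some s1 =>
              let br := s.slotBr t v
              if br = NOBR then none
              else
                let wlo := TWOPI_LO - (sh - brHi br)
                let whi := TWOPI_HI - (sl - brLo br)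
                match s1.trimSide t v 0 wlo whi with
                | none => none
                | some s2 => match s2.trimSide t v 1 wlo whi with
                  | none => none
                  | some s3 => s3.trimSide t v 2 wlo whi) (some s1)) ≠ none ∧
          ∀ s', (L.foldl (fun os t => match os with
            | none => none
            | some s1 =>
              let br := s.slotBr t v
              if br = NOBR then none
              else
                let wlo := TWOPI_LO - (sh - brHi br)
                let whi := TWOPI_HI - (sl - brLo br)
                match s1.trimSide t v 0 wlo whi with
                | none => none
                | some s2 => match s2.trimSide t v 1 wlo whi with
                  | none => none
                  | some s3 => s3.trimSide t v 2 wlo whi) (some s1)) = some s' →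
            Realizes M s' ∧ s'.tris = s.tris := by
        intro L
        induction L with
        | nil => intro _ s1 hs1 htr; simp [hs1, htr]
        | cons t L ih =>
          intro hL s1 hs1 htr
          rw [List.foldl_cons]
          have ht := hL t (by simp)
          have htl := mem_trisAt.1 ht
          simp only [hfeas t ht, ↓reduceIte]
          have hw := window_of_closed hR hv hne ht hsl hsh
          have hvt : v ∈ tset t := tmem_iff.1 htl.2
          obtain ⟨n1, k1⟩ := trimSide_sound hs1 (by rw [htr]; exact htl.1) hvt 0 _ _ hw
          obtain ⟨s2, es2⟩ := Option.ne_none_iff_exists'.1 n1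
          obtain ⟨hs2, t2, -⟩ := k1 s2 es2
          simp only [es2]
          obtain ⟨n2, k2⟩ := trimSide_sound hs2 (by rw [t2, htr]; exact htl.1) hvt 1 _ _ hw
          obtain ⟨s3, es3⟩ := Option.ne_none_iff_exists'.1 n2
          obtain ⟨hs3, t3, -⟩ := k2 s3 es3
          simp only [es3]
          obtain ⟨n3, k3⟩ := trimSide_sound hs3 (by rw [t3, t2, htr]; exact htl.1) hvt 2 _ _ hw
          obtain ⟨s4, es4⟩ := Option.ne_none_iff_exists'.1 n3
          obtain ⟨hs4, t4, -⟩ := k3 s4 es4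
          rw [es4]
          exact ih (fun t' ht' => hL t' (by simp [ht'])) s4 hs4 (by rw [t4, t3, t2, htr])
      exact gen _ (fun t ht => ht) s hR rfl
    · -- open label
      rw [if_neg hne0]
      have hkill : ¬ TWOPI_HI ≤ sl + THMIN := by
        intro h
        rw [e2] at hne0
        obtain ⟨u, hu⟩ := List.exists_mem_of_ne_nil ((List.range' 0 12).filter fun u => u ≠ v ∧ s.gsc v u = 1)
          (fun h' => hne0 (by rw [h']; rfl))
        simp only [List.mem_filter, List.mem_range'_1, decide_eq_true_eq] at hu
        obtain ⟨hu12, huv, h1⟩ := hu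
        obtain ⟨t'', hT, hv'', -, hun⟩ := exists_unplaced_of_gsc_one hR hv (by omega) huv.symm h1
        have hle := sum_ang_trisAt_add_le hR hv hT hv'' hun
        have hth := THMIN_mul_le_ang M hT hv''
        have h2hi := lt_TWOPI_HI_mul
        have hδ := delta_pos
        have : ((TWOPI_HI : ℕ) : ℝ) * (δ : ℝ) ≤ ((sl + THMIN : ℕ) : ℝ) * δ :=
          mul_le_mul_of_nonneg_right (by exact_mod_cast h) hδ.le
        rw [Nat.cast_add, add_mul] at this
        linarith
      rw [if_neg hkill]
      exact ⟨by simp, fun s' h => by cases h; exact ⟨hR, rfl⟩⟩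

end Node

/-! ### Part D. Local steps and propagation -/

section Propagation

variable {M : KConf} {s : St}

/-- **Soundness of `localStep`.** [folklore] -/
theorem localStep_sound (hR : Realizes M s) {v : ℕ} (hv : v < 12) :
    s.localStep v ≠ none ∧ ∀ s', s.localStep v = some s' → Realizes M s' ∧ s'.tris = s.tris := by
  unfold St.localStep
  obtain ⟨n1, k1⟩ := trimTrisAt_sound hR v
  obtain ⟨s1, e1⟩ := Option.ne_none_iff_exists'.1 n1
  obtain ⟨hs1, t1⟩ := k1 s1 e1
  simp only [e1]
  obtain ⟨n2, k2⟩ := pairRulesAt_sound hs1 hv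
  obtain ⟨s2, e2⟩ := Option.ne_none_iff_exists'.1 n2
  obtain ⟨hs2, t2⟩ := k2 s2 e2
  simp only [e2]
  obtain ⟨n3, k3⟩ := nodeRule_sound hs2 hv
  exact ⟨n3, fun s' h => let ⟨q1, q2⟩ := k3 s' h; ⟨q1, by rw [q2, t2, t1]⟩⟩

/-- **Soundness of `propagateWL`**: propagation never kills a realized state and keeps it
realized (with the same triangles). [cite: Moore1966, §4.4] -/
theorem propagateWL_sound : ∀ (fuel : ℕ) (dirty : List ℕ) (s : St), Realizes M s →
    s.propagateWL fuel dirty ≠ none ∧ ∀ s', s.propagateWL fuel dirty = some s' → Realizes M s' ∧ s'.tris = s.tris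
  | 0, dirty, s, hR => by unfold St.propagateWL; simp [hR]
  | fuel + 1, [], s, hR => by unfold St.propagateWL; simp [hR]
  | fuel + 1, v :: rest, s, hR => by
    unfold St.propagateWL
    by_cases hv : 12 ≤ v
    · rw [if_pos hv]; exact propagateWL_sound fuel rest s hR
    · rw [if_neg hv]
      obtain ⟨n1, k1⟩ := localStep_sound hR (not_le.1 hv)
      obtain ⟨s1, e1⟩ := Option.ne_none_iff_exists'.1 n1
      obtain ⟨hs1, t1⟩ := k1 s1 e1
      simp only [e1]
      obtain ⟨n2, k2⟩ := propagateWL_sound fuel _ s1 hs1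
      exact ⟨n2, fun s' h => let ⟨q1, q2⟩ := k2 s' h; ⟨q1, q2.trans t1⟩⟩

/-- **Soundness of `propagate`.** [folklore] -/
theorem propagate_sound (hR : Realizes M s) (fuel : ℕ) :
    s.propagate fuel ≠ none ∧ ∀ s', s.propagate fuel = some s' → Realizes M s' ∧ s'.tris = s.tris :=
  propagateWL_sound fuel _ s hR

end Propagation

end KissingSearch

end Literature.Geometry.DiscreteGeometry
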